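import Literature.Analysis.FunctionSpaces.PVFunctions
import HarnessLib

/-!
# Programming in Cobham's algebra: comparison, definition by cases, truncated subtraction

Support for the witnessing theorem of Buss's `S₂¹` in its machine-independent form
(`Σᵇ₁`-definable in `S₂¹` ⇒ `PV`-definable; Buss 1986, Ch. 5–6; Krajíček 1995, §7.6): the
model-theoretic proof needs, as *function symbols of `PV`* (terms `f : PVFun n` of Cook's /
Cobham's algebra, `PVFunctions.lean`) with their standard interpretation `PVFun.eval` on `ℕ`,

* `PVFun.mspLen` — `MSP` by a length, `(x, u) ↦ ⌊x / 2^{|u|}⌋` (limited recursion on the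
  notation of `u`);
* `PVFun.pfx` — the prefix of `b` *aligned* with a prefix `y` of `a`:
  `(a, b, y) ↦ ⌊b / 2^{|a| - |y|}⌋`; this is how two notations are traversed simultaneously by a
  recursion on one of them;
* `PVFun.cmp` — three-valued comparison (`0`: `a = b`, `1`: `a < b`, `2`: `b < a`), by recursion
  on the notation of `a` comparing prefixes of equal length (most significant bit first);
* the indicators `PVFun.leInd`, `PVFun.eqInd`, `PVFun.ltInd` (values in `{0, 1}`), Boolean
  combinators `notInd`, `andInd`, `orInd`, definition by cases `PVFun.sel a b c d =
  if a ≤ b then c else d`, `PVFun.minT`;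
* `PVFun.monus` — truncated subtraction `a ∸ b` (recursion on the notation of `a`, subtracting the
  aligned prefixes of `b` with borrow read off from `cmp`), and `PVFun.lspLen` —
  `(v, c) ↦ v mod 2^{|c|}`.

Each symbol comes with its `eval` lemma on `ℕ`.  These are the standard first derived functions
of `PV` (Cook 1975, §2: `TR`, parity, conditional, `LESS`, monus are among the functions
introduced right after the definition of `PV`; Buss 1986, Ch. 6), here obtained in the particular
basis of `PVFun` (initial functions `0, sᵢ, ⌊x/2⌋, |x|, #, +, ·, cond`).

## References

* S. A. Cook, *Feasibly constructive proofs and the propositional calculus*, STOC 1975, §2.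
* S. R. Buss, *Bounded Arithmetic*, Bibliopolis 1986, Ch. 6 (the theory `PV`, its derived
  functions).
* A. Cobham, *The intrinsic computational difficulty of functions*, 1965.

## Design choices

* Small combinators `ap₁/ap₂/ap₃` (a symbol applied to terms), `wk` (a dummy last argument) and
  the numerals `zero'`, `one'`, `two'` keep the terms readable; all are `PVFun.comp` underneath.
* Recursions are on the *last* argument (the convention of `PVFun.limRec`); a function recursing
  on one of its own parameters (e.g. `cmp a b` recurses on a copy of `a`) is obtained by
  composing a three-place recursion with `(a, b) ↦ (a, b, a)`.
* Specifications are stated on `Matrix.vecCons` tuples (`f.eval ![a, b]`), proved from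
  `Fin.snoc` forms (the shape of `eval_limRec_zero/bit`).
-/

namespace Literature.Analysis.FunctionSpaces

namespace PVFun

variable {n m : ℕ}

/-! ## Term-building combinators -/

/-- A unary symbol applied to a term. [folklore] -/
def ap₁ (f : PVFun 1) (t : PVFun n) : PVFun n := comp f ![t]

/-- A binary symbol applied to two terms. [folklore] -/
def ap₂ (f : PVFun 2) (t u : PVFun n) : PVFun n := comp f ![t, u]

/-- A ternary symbol applied to three terms. [folklore] -/
def ap₃ (f : PVFun 3) (t u w : PVFun n) : PVFun n := comp f ![t, u, w]

/-- The numeral `0` in any arity. [folklore] -/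
def zero' : PVFun n := comp zero ![]

/-- The numeral `1 = s₁ 0` in any arity. [folklore] -/
def one' : PVFun n := ap₁ (bit true) zero'

/-- The numeral `2 = s₀ (s₁ 0)` in any arity. [folklore] -/
def two' : PVFun n := ap₁ (bit false) one'

/-- Weakening: `f` as a function of one more (ignored, last) argument. [folklore] -/
def wk (f : PVFun n) : PVFun (n + 1) := comp f fun i => proj (Fin.castSucc i)

/-- Semantics of `ap₁`. [folklore] -/
@[simp] theorem eval_ap₁ (f : PVFun 1) (t : PVFun n) (x : Fin n → ℕ) :
    (ap₁ f t).eval x = f.eval ![t.eval x] := by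
  rw [ap₁, eval_comp]; congr 1; funext i; fin_cases i; rfl

/-- Semantics of `ap₂`. [folklore] -/
@[simp] theorem eval_ap₂ (f : PVFun 2) (t u : PVFun n) (x : Fin n → ℕ) :
    (ap₂ f t u).eval x = f.eval ![t.eval x, u.eval x] := by
  rw [ap₂, eval_comp]; congr 1; funext i; fin_cases i <;> rfl

/-- Semantics of `ap₃`. [folklore] -/
@[simp] theorem eval_ap₃ (f : PVFun 3) (t u w : PVFun n) (x : Fin n → ℕ) :
    (ap₃ f t u w).eval x = f.eval ![t.eval x, u.eval x, w.eval x] := by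
  rw [ap₃, eval_comp]; congr 1; funext i; fin_cases i <;> rfl

/-- Semantics of `zero'`. [folklore] -/
@[simp] theorem eval_zero' (x : Fin n → ℕ) : (zero' : PVFun n).eval x = 0 := rfl

/-- Semantics of `one'`. [folklore] -/
@[simp] theorem eval_one' (x : Fin n → ℕ) : (one' : PVFun n).eval x = 1 := by
  simp [one']

/-- Semantics of `two'`. [folklore] -/
@[simp] theorem eval_two' (x : Fin n → ℕ) : (two' : PVFun n).eval x = 2 := by
  simp [two']

/-- Semantics of weakening. [folklore] -/
@[simp] theorem eval_wk (f : PVFun n) (x : Fin n → ℕ) (a : ℕ) :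
    (wk f).eval (Fin.snoc x a) = f.eval x := by
  rw [wk, eval_comp]; congr 1; funext i; simp

/-- A `Fin 1`-tuple is `![x 0]`. [folklore] -/
theorem vec1_eq (x : Fin 1 → ℕ) : x = ![x 0] := by funext i; fin_cases i; rfl

/-- A `Fin 2`-tuple is `![x 0, x 1]`. [folklore] -/
theorem vec2_eq (x : Fin 2 → ℕ) : x = ![x 0, x 1] := by funext i; fin_cases i <;> rfl

/-- A `Fin 3`-tuple is `![x 0, x 1, x 2]`. [folklore] -/
theorem vec3_eq (x : Fin 3 → ℕ) : x = ![x 0, x 1, x 2] := by funext i; fin_cases i <;> rfl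

/-- `Fin.snoc ![a] b = ![a, b]`. [folklore] -/
@[simp] theorem snoc_vec1 (a b : ℕ) : (Fin.snoc ![a] b : Fin 2 → ℕ) = ![a, b] := by
  funext i; fin_cases i <;> rfl

/-- `Fin.snoc ![a, b] c = ![a, b, c]`. [folklore] -/
@[simp] theorem snoc_vec2 (a b c : ℕ) : (Fin.snoc ![a, b] c : Fin 3 → ℕ) = ![a, b, c] := by
  funext i; fin_cases i <;> rfl

/-- `Fin.snoc ![a, b, c] d = ![a, b, c, d]`. [folklore] -/
@[simp] theorem snoc_vec3 (a b c d : ℕ) :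
    (Fin.snoc ![a, b, c] d : Fin 4 → ℕ) = ![a, b, c, d] := by
  funext i; fin_cases i <;> rfl

/-- `Fin.snoc ![] a = ![a]`. [folklore] -/
@[simp] theorem snoc_vec0 (a : ℕ) : (Fin.snoc ![] a : Fin 1 → ℕ) = ![a] := by
  funext i; fin_cases i; rfl

/-! ## Arithmetic of binary length -/

/-- `|⌊a / 2ᵏ⌋| = |a| - k`. [folklore] -/
theorem size_div_two_pow (a k : ℕ) : Nat.size (a / 2 ^ k) = Nat.size a - k := by
  apply le_antisymm
  · rw [Nat.size_le]
    rcases le_or_gt k (Nat.size a) with hk | hk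
    · rw [Nat.div_lt_iff_lt_mul (Nat.two_pow_pos k), ← pow_add, Nat.sub_add_cancel hk]
      exact Nat.lt_size_self a
    · rw [Nat.sub_eq_zero_of_le hk.le, pow_zero, Nat.lt_one_iff, Nat.div_eq_zero_iff]
      exact Or.inr ((Nat.lt_size_self a).trans_le (Nat.pow_le_pow_right two_pos hk.le))
  · rcases Nat.eq_zero_or_pos (Nat.size a - k) with h0 | hpos
    · rw [h0]; exact Nat.zero_le _
    · have h1 : Nat.size a - k - 1 < Nat.size (a / 2 ^ k) := by
        rw [Nat.lt_size, Nat.le_div_iff_mul_le (Nat.two_pow_pos k), ← pow_add]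
        have h2 : Nat.size a - k - 1 + k = Nat.size a - 1 := by omega
        rw [h2]
        exact Nat.lt_size.1 (by omega)
      omega

/-- `|bit b y| = |y| + 1` unless `bit b y = 0`. [folklore] -/
theorem size_bit' {b : Bool} {y : ℕ} (hy : y = 0 → b = true) :
    Nat.size (Nat.bit b y) = Nat.size y + 1 :=
  Nat.size_bit (Nat.bit_ne_zero_iff.2 hy)

/-! ## Parity -/

/-- Parity `x ↦ x mod 2` by recursion on notation: `par 0 = 0`, `par (sᵢ y) = i`
(Cook 1975, §2). [cite: Cook1975, §2] -/
def par : PVFun 1 := limRec zero (fun b => bif b then one' else zero') one'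

/-- `par x = x mod 2`. [cite: Cook1975, §2] -/
theorem eval_par_snoc (y : ℕ) : par.eval (Fin.snoc ![] y) = y % 2 := by
  induction y using Nat.binaryRec' with
  | zero => rw [par, eval_limRec_zero]; simp
  | bit b y hy _ =>
    rw [par, eval_limRec_bit _ _ _ _ _ _ hy, Nat.bit_mod_two]
    cases b <;> simp

/-- `par x = x mod 2`. [cite: Cook1975, §2] -/
@[simp] theorem eval_par (x : Fin 1 → ℕ) : par.eval x = x 0 % 2 := by
  rw [vec1_eq x, ← snoc_vec0, eval_par_snoc]; rfl

/-! ## `MSP` by a length -/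

/-- `mspLen (x, u) = ⌊x / 2^{|u|}⌋`: drop as many low bits of `x` as `u` has bits, by recursion
on the notation of `u` (`mspLen (x, 0) = x`, `mspLen (x, sᵢ u) = ⌊mspLen (x, u) / 2⌋`, bound
`x`) (Cook 1975, §2; Buss 1986, Ch. 6: `MSP`). [cite: Buss1986, Ch. 6] -/
def mspLen : PVFun 2 := limRec (proj 0) (fun _ => ap₁ half (proj (Fin.last 2))) (proj 0)

/-- `mspLen (x, u) = ⌊x / 2^{|u|}⌋` (`Fin.snoc` form). [cite: Buss1986, Ch. 6] -/
theorem eval_mspLen_snoc (x u : ℕ) : mspLen.eval (Fin.snoc ![x] u) = x / 2 ^ Nat.size u := by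
  induction u using Nat.binaryRec' with
  | zero => rw [mspLen, eval_limRec_zero]; simp
  | bit b y hy ih =>
    rw [mspLen, eval_limRec_bit _ _ _ _ _ _ hy, ← mspLen, ih, size_bit' hy]
    simp only [eval_ap₁, eval_proj, Fin.snoc_last, eval_half, Matrix.cons_val_zero, pow_succ]
    rw [Nat.div_div_eq_div_mul]
    exact min_eq_left ((Nat.div_le_self _ _))

/-- `mspLen (x, u) = ⌊x / 2^{|u|}⌋`. [cite: Buss1986, Ch. 6] -/
@[simp] theorem eval_mspLen (v : Fin 2 → ℕ) : mspLen.eval v = v 0 / 2 ^ Nat.size (v 1) := by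
  rw [vec2_eq v, ← snoc_vec1, eval_mspLen_snoc]; rfl

/-! ## Aligned prefixes -/

/-- `pfx (a, b, y) = ⌊b / 2^{|a| - |y|}⌋ = mspLen (b, mspLen (a, y))`: when `y = ⌊a/2ᵏ⌋` is a
prefix of the notation of `a`, this is the prefix `⌊b/2ᵏ⌋` of `b` of the corresponding length —
the device by which a recursion on the notation of `a` reads `b` in parallel. [folklore] -/
def pfx : PVFun 3 := ap₂ mspLen (proj 1) (ap₂ mspLen (proj 0) (proj 2))

/-- `pfx (a, b, y) = ⌊b / 2^{|a| - |y|}⌋`. [folklore] -/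
@[simp] theorem eval_pfx (v : Fin 3 → ℕ) :
    pfx.eval v = v 1 / 2 ^ (Nat.size (v 0) - Nat.size (v 2)) := by
  simp [pfx, size_div_two_pow]

/-- Aligned prefixes, one bit further: if `|y| + 1 ≤ |a|` then
`⌊b / 2^{|a| - (|y|+1)}⌋ = 2 · ⌊b / 2^{|a| - |y|}⌋ + (its parity)`, i.e. the shorter prefix is
the longer one halved. [folklore] -/
theorem pfx_step {a b y : ℕ} (h : Nat.size y + 1 ≤ Nat.size a) :
    b / 2 ^ (Nat.size a - Nat.size y) = b / 2 ^ (Nat.size a - (Nat.size y + 1)) / 2 := by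
  rw [Nat.div_div_eq_div_mul, ← pow_succ]
  congr 2; omega

/-! ## Three-valued comparison -/

/-- The three-valued comparison of natural numbers: `0` if equal, `1` if `y < c`, `2` if `c < y`.
[folklore] -/
def cmpNat (y c : ℕ) : ℕ := if y = c then 0 else if y < c then 1 else 2

/-- `cmpNat y c ≤ 2`. [folklore] -/
theorem cmpNat_le (y c : ℕ) : cmpNat y c ≤ 2 := by
  unfold cmpNat; split_ifs <;> omega

/-- `cmpNat y c = 0 ↔ y = c`. [folklore] -/
theorem cmpNat_eq_zero_iff (y c : ℕ) : cmpNat y c = 0 ↔ y = c := by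
  unfold cmpNat
  constructor <;> intro h <;> split_ifs at * <;> first | contradiction | omega

/-- `cmpNat y c = 1 ↔ y < c`. [folklore] -/
theorem cmpNat_eq_one_iff (y c : ℕ) : cmpNat y c = 1 ↔ y < c := by
  unfold cmpNat
  constructor <;> intro h <;> split_ifs at * <;> first | contradiction | omega

/-- `cmpNat y c = 2 ↔ c < y`. [folklore] -/
theorem cmpNat_eq_two_iff (y c : ℕ) : cmpNat y c = 2 ↔ c < y := by
  unfold cmpNat
  constructor <;> intro h <;> split_ifs at * <;> first | contradiction | omega

/-- `cmpNat 0 m`. [folklore] -/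
theorem cmpNat_zero_left (m : ℕ) : cmpNat 0 m = if m = 0 then 0 else 1 := by
  unfold cmpNat; split_ifs <;> first | contradiction | omega

/-- `cmpNat 1 m` for `m < 2`. [folklore] -/
theorem cmpNat_one_left {m : ℕ} (hm : m < 2) : cmpNat 1 m = if m = 0 then 2 else 0 := by
  unfold cmpNat; split_ifs <;> first | contradiction | omega

/-- **The comparison step**: comparing `2y + i` with `2c + j` (`i, j < 2`) is comparing `y` with
`c`, and on a tie comparing `i` with `j`. [folklore] -/
theorem cmpNat_step (y c : ℕ) {i j : ℕ} (hi : i < 2) (hj : j < 2) :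
    cmpNat (2 * y + i) (2 * c + j) = if cmpNat y c = 0 then cmpNat i j else cmpNat y c := by
  unfold cmpNat; split_ifs <;> first | contradiction | omega

/-- The last entry of a `4`-vector. [folklore] -/
@[simp] theorem vec4_last (a b c d : ℕ) : (![a, b, c, d] : Fin 4 → ℕ) (Fin.last 3) = d := rfl

/-- The last entry of a `3`-vector. [folklore] -/
@[simp] theorem vec3_last (a b c : ℕ) : (![a, b, c] : Fin 3 → ℕ) (Fin.last 2) = c := rfl

/-- The last entry of a `2`-vector. [folklore] -/
@[simp] theorem vec2_last (a b : ℕ) : (![a, b] : Fin 2 → ℕ) (Fin.last 1) = b := rfl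

/-- The comparison step for the bit `false`: compare `0` with the parity `j`. [folklore] -/
def cmpStepF : PVFun 4 :=
  ap₃ cond (ap₁ par (ap₃ pfx (proj 0) (proj 1) (ap₁ (bit false) (proj 2)))) zero' one'

/-- The comparison step for the bit `true`: compare `1` with the parity `j`. [folklore] -/
def cmpStepT : PVFun 4 :=
  ap₃ cond (ap₁ par (ap₃ pfx (proj 0) (proj 1) (ap₁ (bit true) (proj 2)))) two' zero'

/-- `cmp3 (a, b, y)`: the comparison of the prefix `y` of `a` with the aligned prefix of `b`, by
recursion on the notation of `y`: at `y = 0` compare `0` with `⌊b/2^{|a|}⌋`; at `sᵢ y`, keep a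
decided comparison, and on a tie compare the new bits (Cook 1975, §2, `LESS`; here most
significant bit first). [cite: Cook1975, §2] -/
def cmp3 : PVFun 3 :=
  limRec (ap₃ cond (ap₂ mspLen (proj 1) (proj 0)) zero' one')
    (fun i => ap₃ cond (proj (Fin.last 3)) (bif i then cmpStepT else cmpStepF) (proj (Fin.last 3)))
    two'

/-- Semantics of the comparison steps: compare the bit `i` with the parity of the aligned prefix.
[folklore] -/
theorem eval_cmpStep (i : Bool) (a b y r : ℕ) :
    (bif i then cmpStepT else cmpStepF).eval ![a, b, y, r] =
      cmpNat i.toNat (b / 2 ^ (Nat.size a - Nat.size (Nat.bit i y)) % 2) := by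
  have hm : b / 2 ^ (Nat.size a - Nat.size (Nat.bit i y)) % 2 < 2 := Nat.mod_lt _ two_pos
  cases i
  · simp only [cond_false, cmpStepF, eval_ap₃, eval_ap₁, eval_cond, eval_par, eval_pfx, eval_proj,
      eval_bit, eval_zero', eval_one', Matrix.cons_val_zero, Matrix.cons_val_one, Matrix.cons_val,
      Bool.toNat_false, cmpNat_zero_left]
  · simp only [cond_true, cmpStepT, eval_ap₃, eval_ap₁, eval_cond, eval_par, eval_pfx, eval_proj,
      eval_bit, eval_zero', eval_two', Matrix.cons_val_zero, Matrix.cons_val_one, Matrix.cons_val,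
      Bool.toNat_true]
    rw [cmpNat_one_left hm]

/-- **Correctness of `cmp3` on prefixes**: for `|y| ≤ |a|`,
`cmp3 (a, b, y) = cmpNat y ⌊b / 2^{|a| - |y|}⌋`. [cite: Cook1975, §2] -/
theorem eval_cmp3_snoc (a b : ℕ) : ∀ y : ℕ, Nat.size y ≤ Nat.size a →
    cmp3.eval (Fin.snoc ![a, b] y) = cmpNat y (b / 2 ^ (Nat.size a - Nat.size y)) := by
  intro y
  induction y using Nat.binaryRec' with
  | zero =>
    intro _
    rw [cmp3, eval_limRec_zero]
    simp only [eval_ap₃, eval_ap₂, eval_proj, eval_mspLen, eval_cond, eval_zero', eval_one',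
      eval_two', Matrix.cons_val_zero, Matrix.cons_val_one, Nat.size_zero, Nat.sub_zero, snoc_vec2,
      cmpNat_zero_left]
    split_ifs <;> simp
  | bit i y hy ih =>
    intro hsz
    rw [size_bit' hy] at hsz
    have ih' := ih (by omega)
    rw [cmp3, eval_limRec_bit _ _ _ _ _ _ hy, ← cmp3, ih', pfx_step hsz]
    simp only [eval_ap₃, eval_cond, eval_proj, snoc_vec2, snoc_vec3, vec4_last,
      eval_two', Matrix.cons_val_zero, Matrix.cons_val_one, Matrix.cons_val]
    rw [eval_cmpStep, size_bit' hy]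
    clear ih ih'
    generalize b / 2 ^ (Nat.size a - (Nat.size y + 1)) = c'
    have key := cmpNat_step y (c' / 2) (Bool.toNat_lt i) (Nat.mod_lt c' two_pos)
    rw [Nat.div_add_mod c' 2] at key
    rw [Nat.bit_val, key]
    refine min_eq_left ?_
    split_ifs <;> exact cmpNat_le _ _

/-- `cmp (a, b) = cmpNat a b`: three-valued comparison as a `PV` symbol (Cook 1975, §2).
[cite: Cook1975, §2] -/
def cmp : PVFun 2 := comp cmp3 ![proj 0, proj 1, proj 0]

/-- **`cmp` computes the comparison.** [cite: Cook1975, §2] -/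
@[simp] theorem eval_cmp (v : Fin 2 → ℕ) : cmp.eval v = cmpNat (v 0) (v 1) := by
  rw [cmp, eval_comp]
  have e : (fun i => (![proj 0, proj 1, proj 0] i : PVFun 2).eval v) = Fin.snoc ![v 0, v 1] (v 0) := by
    funext i; fin_cases i <;> rfl
  rw [e, eval_cmp3_snoc _ _ _ le_rfl]
  simp

/-! ## Indicators, Boolean combinators, definition by cases -/

/-- `leInd (a, b) = 1` if `a ≤ b`, else `0`. [cite: Cook1975, §2] -/
def leInd : PVFun 2 := ap₃ cond (ap₁ half cmp) one' zero'

/-- `eqInd (a, b) = 1` if `a = b`, else `0`. [cite: Cook1975, §2] -/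
def eqInd : PVFun 2 := ap₃ cond cmp one' zero'

/-- `ltInd (a, b) = 1` if `a < b`, else `0`. [cite: Cook1975, §2] -/
def ltInd : PVFun 2 := ap₃ cond cmp zero' (ap₃ cond (ap₁ half cmp) one' zero')

/-- `leInd` is the indicator of `≤`. [cite: Cook1975, §2] -/
@[simp] theorem eval_leInd (v : Fin 2 → ℕ) : leInd.eval v = if v 0 ≤ v 1 then 1 else 0 := by
  simp only [leInd, eval_ap₃, eval_ap₁, eval_cond, eval_half, eval_cmp, eval_one', eval_zero',
    Matrix.cons_val_zero, Matrix.cons_val_one, Matrix.cons_val]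
  unfold cmpNat
  split_ifs <;> first | rfl | contradiction | omega

/-- `eqInd` is the indicator of `=`. [cite: Cook1975, §2] -/
@[simp] theorem eval_eqInd (v : Fin 2 → ℕ) : eqInd.eval v = if v 0 = v 1 then 1 else 0 := by
  simp only [eqInd, eval_ap₃, eval_cond, eval_cmp, eval_one', eval_zero',
    Matrix.cons_val_zero, Matrix.cons_val_one, Matrix.cons_val]
  unfold cmpNat
  split_ifs <;> first | rfl | contradiction

/-- `ltInd` is the indicator of `<`. [cite: Cook1975, §2] -/
@[simp] theorem eval_ltInd (v : Fin 2 → ℕ) : ltInd.eval v = if v 0 < v 1 then 1 else 0 := by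
  simp only [ltInd, eval_ap₃, eval_ap₁, eval_cond, eval_half, eval_cmp, eval_one', eval_zero',
    Matrix.cons_val_zero, Matrix.cons_val_one, Matrix.cons_val]
  unfold cmpNat
  split_ifs <;> first | rfl | contradiction | omega

/-- Negation of an indicator: `notInd t = 1` if `t = 0`, else `0`. [folklore] -/
def notInd (t : PVFun n) : PVFun n := ap₃ cond t one' zero'

/-- Conjunction of indicators: `andInd t u = 0` if `t = 0`, else `u`. [folklore] -/
def andInd (t u : PVFun n) : PVFun n := ap₃ cond t zero' u

/-- Disjunction of indicators: `orInd t u = u` if `t = 0`, else `1`. [folklore] -/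
def orInd (t u : PVFun n) : PVFun n := ap₃ cond t u one'

/-- Semantics of `notInd`. [folklore] -/
@[simp] theorem eval_notInd (t : PVFun n) (x : Fin n → ℕ) :
    (notInd t).eval x = if t.eval x = 0 then 1 else 0 := by
  simp [notInd]

/-- Semantics of `andInd`. [folklore] -/
@[simp] theorem eval_andInd (t u : PVFun n) (x : Fin n → ℕ) :
    (andInd t u).eval x = if t.eval x = 0 then 0 else u.eval x := by
  simp [andInd]

/-- Semantics of `orInd`. [folklore] -/
@[simp] theorem eval_orInd (t u : PVFun n) (x : Fin n → ℕ) :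
    (orInd t u).eval x = if t.eval x = 0 then u.eval x else 1 := by
  simp [orInd]

/-- **Definition by cases on a comparison**: `sel (a, b, c, d) = c` if `a ≤ b`, `= d` otherwise
(Cook 1975, §2; Krajíček 1995, §5.3: `PV` is closed under definition by cases).
[cite: Cook1975, §2] -/
def sel : PVFun 4 := ap₃ cond (ap₂ leInd (proj 0) (proj 1)) (proj 3) (proj 2)

/-- `sel (a, b, c, d) = if a ≤ b then c else d`. [cite: Cook1975, §2] -/
@[simp] theorem eval_sel (v : Fin 4 → ℕ) : sel.eval v = if v 0 ≤ v 1 then v 2 else v 3 := by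
  simp only [sel, eval_ap₃, eval_ap₂, eval_cond, eval_leInd, eval_proj, Matrix.cons_val_zero,
    Matrix.cons_val_one, Matrix.cons_val]
  split_ifs <;> first | rfl | contradiction

/-- The term `sel (t, u, w, z)`. [folklore] -/
def selT (t u w z : PVFun n) : PVFun n := comp sel ![t, u, w, z]

/-- Semantics of `selT`. [folklore] -/
@[simp] theorem eval_selT (t u w z : PVFun n) (x : Fin n → ℕ) :
    (selT t u w z).eval x = if t.eval x ≤ u.eval x then w.eval x else z.eval x := by
  rw [selT, eval_comp]
  have e : (fun i => (![t, u, w, z] i).eval x) = ![t.eval x, u.eval x, w.eval x, z.eval x] := by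
    funext i; fin_cases i <;> rfl
  rw [e, eval_sel]
  simp

/-- The term `min (t, u)`. [folklore] -/
def minT (t u : PVFun n) : PVFun n := selT t u t u

/-- Semantics of `minT`. [folklore] -/
@[simp] theorem eval_minT (t u : PVFun n) (x : Fin n → ℕ) :
    (minT t u).eval x = min (t.eval x) (u.eval x) := by
  rw [minT, eval_selT]
  split_ifs with h
  · exact (min_eq_left h).symm
  · exact (min_eq_right (not_le.1 h).le).symm

/-! ## Truncated subtraction -/

/-- The subtraction step for the bit `false`: from `r = y ∸ c` to `(2y) ∸ (2c + j)`, namely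
`2r` if `j = 0` and `2r - 1` if `j = 1` (used only when no borrow out occurs). [folklore] -/
def subStepF : PVFun 4 :=
  ap₃ cond (ap₁ par (ap₃ pfx (proj 0) (proj 1) (ap₁ (bit false) (proj 2))))
    (ap₁ (bit false) (proj 3)) (ap₁ pred (ap₁ (bit false) (proj 3)))

/-- The subtraction step for the bit `true`: from `r = y ∸ c` to `(2y + 1) ∸ (2c + j)`, namely
`2r + 1` if `j = 0` and `2r` if `j = 1`. [folklore] -/
def subStepT : PVFun 4 :=
  ap₃ cond (ap₁ par (ap₃ pfx (proj 0) (proj 1) (ap₁ (bit true) (proj 2))))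
    (ap₁ (bit true) (proj 3)) (ap₁ (bit false) (proj 3))

/-- `sub3 (a, b, y) = y ∸ ⌊b / 2^{|a| - |y|}⌋` for prefixes `y` of `a`: recursion on the
notation of `y`, the borrow being read off from the comparison `cmp3` of the extended prefixes
(Cook 1975, §2: monus is a derived function of `PV`). [cite: Cook1975, §2] -/
def sub3 : PVFun 3 :=
  limRec zero'
    (fun i => ap₃ cond
      (ap₂ ltInd (ap₁ (bit i) (proj 2)) (ap₃ pfx (proj 0) (proj 1) (ap₁ (bit i) (proj 2))))
      (bif i then subStepT else subStepF) zero')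
    (proj (Fin.last 2))

/-- Semantics of the subtraction steps. [folklore] -/
theorem eval_subStep (i : Bool) (a b y r : ℕ) :
    (bif i then subStepT else subStepF).eval ![a, b, y, r] =
      if b / 2 ^ (Nat.size a - Nat.size (Nat.bit i y)) % 2 = 0 then 2 * r + i.toNat
      else 2 * r + i.toNat - 1 := by
  cases i
  · simp only [cond_false, subStepF, eval_ap₃, eval_ap₁, eval_cond, eval_par, eval_pfx, eval_proj,
      eval_bit, eval_pred, Matrix.cons_val_zero, Matrix.cons_val_one, Matrix.cons_val,
      Bool.toNat_false, Nat.bit_val, add_zero]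
  · simp only [cond_true, subStepT, eval_ap₃, eval_ap₁, eval_cond, eval_par, eval_pfx, eval_proj,
      eval_bit, Matrix.cons_val_zero, Matrix.cons_val_one, Matrix.cons_val, Bool.toNat_true,
      Bool.toNat_false, Nat.bit_val, add_zero, Nat.add_sub_cancel]

/-- **The subtraction step** on numbers: for `i, j < 2`, `(2y + i) ∸ (2c + j)` is `0` if
`2y + i < 2c + j`, and otherwise `2(y ∸ c) + i - j` (no borrow out of the high part). [folklore] -/
theorem sub_step (y c : ℕ) {i j : ℕ} (hi : i < 2) (hj : j < 2) :
    2 * y + i - (2 * c + j) =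
      if 2 * y + i < 2 * c + j then 0
      else if j = 0 then 2 * (y - c) + i else 2 * (y - c) + i - 1 := by
  split_ifs <;> omega

/-- **Correctness of `sub3` on prefixes**: for `|y| ≤ |a|`,
`sub3 (a, b, y) = y - ⌊b / 2^{|a| - |y|}⌋` (truncated). [cite: Cook1975, §2] -/
theorem eval_sub3_snoc (a b : ℕ) : ∀ y : ℕ, Nat.size y ≤ Nat.size a →
    sub3.eval (Fin.snoc ![a, b] y) = y - b / 2 ^ (Nat.size a - Nat.size y) := by
  intro y
  induction y using Nat.binaryRec' with
  | zero => intro _; rw [sub3, eval_limRec_zero]; simp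
  | bit i y hy ih =>
    intro hsz
    rw [size_bit' hy] at hsz
    have ih' := ih (by omega)
    rw [sub3, eval_limRec_bit _ _ _ _ _ _ hy, ← sub3, ih', pfx_step hsz]
    simp only [eval_ap₃, eval_ap₂, eval_ap₁, eval_cond, eval_ltInd, eval_pfx, eval_proj, eval_bit,
      eval_zero', snoc_vec2, snoc_vec3, vec3_last, Matrix.cons_val_zero, Matrix.cons_val_one,
      Matrix.cons_val]
    rw [eval_subStep, size_bit' hy]
    clear ih ih'
    generalize b / 2 ^ (Nat.size a - (Nat.size y + 1)) = c'
    have key := sub_step y (c' / 2) (Bool.toNat_lt i) (Nat.mod_lt c' two_pos)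
    rw [Nat.div_add_mod c' 2] at key
    rw [Nat.bit_val, key]
    have h4 := Bool.toNat_lt i
    rw [min_eq_left]
    · split_ifs <;> first | contradiction | omega
    · split_ifs <;> first | contradiction | omega

/-- Truncated subtraction `monus (a, b) = a ∸ b` as a `PV` symbol (Cook 1975, §2).
[cite: Cook1975, §2] -/
def monus : PVFun 2 := comp sub3 ![proj 0, proj 1, proj 0]

/-- **`monus` computes truncated subtraction.** [cite: Cook1975, §2] -/
@[simp] theorem eval_monus (v : Fin 2 → ℕ) : monus.eval v = v 0 - v 1 := by
  rw [monus, eval_comp]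
  have e : (fun i => (![proj 0, proj 1, proj 0] i : PVFun 2).eval v) = Fin.snoc ![v 0, v 1] (v 0) := by
    funext i; fin_cases i <;> rfl
  rw [e, eval_sub3_snoc _ _ _ le_rfl]
  simp

/-- `lspLen (v, c) = v mod 2^{|c|} = v ∸ ⌊v / 2^{|c|}⌋ · (1 # c)` (Buss 1986, Ch. 6: `LSP`).
[cite: Buss1986, Ch. 6] -/
def lspLen : PVFun 2 := ap₂ monus (proj 0) (ap₂ mul (ap₂ mspLen (proj 0) (proj 1)) (ap₂ smash one' (proj 1)))

/-- **`lspLen` computes `v mod 2^{|c|}`.** [cite: Buss1986, Ch. 6] -/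
@[simp] theorem eval_lspLen (v : Fin 2 → ℕ) : lspLen.eval v = v 0 % 2 ^ Nat.size (v 1) := by
  simp only [lspLen, eval_ap₂, eval_monus, eval_mul, eval_mspLen, eval_smash, eval_one', eval_proj,
    Matrix.cons_val_zero, Matrix.cons_val_one, Nat.size_one, one_mul]
  have h := Nat.div_add_mod (v 0) (2 ^ Nat.size (v 1))
  rw [mul_comm] at h
  omega

end PVFun

end Literature.Analysis.FunctionSpaces
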